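import Summits.ABC.ABC.Theorems.TowerFourSubLiouville.Negative.Framing

/-!
# `TowerFourSubLiouville` (stmt-ABC-1649): the Liouville end holds with constant `1` and no `ε`, and the
crux is equivalent to its constant-free form

Negative-side calibration (standing disprover, cycle 6, refuter-cdisprove-stmt-ABC-1649-g6-0) of the two
remaining "free parameters" of the crux `∃ A < 2, ∀ ε > 0, ∃ C > 0, … c < C · Π^{A+ε}`: the constant `C`
and the `ε`.  The earlier cycles calibrated them at the conjectural optimum `A = 1` (`ε` cannot be dropped,
`Negative.DialCalibration.not_towerIneq4OneNoEps`; even `(log c)^A`, `A < 1`, fails, `Negative.LogLoss`) and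
at `C = 1` from below (`not_towerIneq4_constant_one_exponent_13_10`: the point `1 + 4374 = 4375`, `Π = 630`,
forces every `C = 1` exponent above `13/10`).  This file settles them at and near the top of the dial:

* `towerPoint_lt_towerProd_sq` — **the trivial ("Liouville") bound holds with `C = 1` and `ε = 0`**:
  every positive level-4 tower point `a + b = c` (coprime or not) has `c < Π²` *strictly*.  Elementary:
  with the exact slack identity `Π⁴ = abc·E`, `E = (x₀y₀z₀)³(x₁y₁z₁)²(x₂y₂z₂)` (`towerProd_pow_four_eq`),
  `c < Π²` is `c < ab·E`; if `E ≥ 2` this is `a + b < 2ab` unless `a = b = 1` (then `c = 2`, `Π⁴ = 2E`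
  forces `Π ≥ 2`); if `E = 1` the point is `X⁴ + Y⁴ = Z⁴` and `Z < XY` is immediate (`X = 1` is
  impossible as `Z⁴ − Y⁴ ≥ (Y+1)⁴ − Y⁴ > 1`, and `X, Y ≥ 2` gives `X⁴Y⁴ > X⁴ + Y⁴`) — Fermat's theorem
  for exponent `4` is *not* needed.  Consequently `2 ≤ Π` on every point (`two_le_towerProd`) and the
  *tower quality* `log c / log Π` of every single point is `< 2`.
* `towerFourSubLiouville_constantFree` — **crux ⟹ its constant-free form**
  `∃ A < 2, ∀ positive coprime points, c < Π^A` (no `C`, no `ε`).  The converse is trivial (`C = 1`,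
  `Π ≥ 1`), so the crux is EQUIVALENT to `sup_{points} log c / log Π < 2`, a statement about the supremum
  of one explicit set of reals each of which is `< 2` (the supremum is `≥ 1.30066`, attained at
  `1 + 2·3⁷ = 5⁴·7`, `Negative.DialCalibration.quality_point_4375`).  Proof: beyond `Π ≥ C^{1/ε}` the
  constant is absorbed by `Π^ε`; below it there are only points with `c ≤ Π² − 1`, and
  `Π^A ≥ Π² − 1` for all `Π ≤ P₀` once `P₀^{2−A} ≤ 1 + P₀⁻²`.
  For the disprover this closes a door: the natural strengthening "`C = 1`, `ε = 0`" of the crux is not a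
  separate (easier) refutation target — it is the crux.  For provers: one may aim at the clean form.

No `sorry`; axioms standard.  Only `Negative.Framing` (for `towerProd_pow_four_eq`) is imported.
-/

-- `Summit.ABC.ABC` is the mandated summit-side namespace (CONVENTIONS §2); the duplicate is deliberate.
set_option linter.dupNamespace false

namespace Summit.ABC.ABC.Theorems.TowerFourSubLiouville.Negative

open scoped BigOperators
open Summit.ABC.ABC.Theses.IneffectiveSubspace

/-- `∏ᵢ xᵢ^{i+1} = x₀ x₁² x₂³ x₃⁴` on `Fin 4`. -/
theorem prod_pow_succ_four (x : Fin 4 → ℕ) :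
    (∏ i, x i ^ (i.val + 1)) = x 0 * x 1 ^ 2 * x 2 ^ 3 * x 3 ^ 4 := by
  simp only [Fin.prod_univ_four, Fin.isValue, Fin.val_zero, Fin.val_one, Fin.val_two]
  simp only [show (3 : Fin 4).val = 3 from rfl]
  ring

/-- `∏ᵢ xᵢyᵢzᵢ` on `Fin 4`, expanded. -/
theorem prod_mul_four (x y z : Fin 4 → ℕ) :
    (∏ i, x i * y i * z i) =
      (x 0 * y 0 * z 0) * (x 1 * y 1 * z 1) * (x 2 * y 2 * z 2) * (x 3 * y 3 * z 3) := by
  simp only [Fin.prod_univ_four]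

/-- The arithmetic heart of the `E = 1` case: positive naturals with `X⁴ + Y⁴ = Z⁴` would have `Z < XY`
(so such a point could never be Liouville-extremal; of course none exists, but that is not used). -/
theorem lt_mul_of_pow_four_add (X Y Z : ℕ) (hX : 0 < X) (hY : 0 < Y) (h : X ^ 4 + Y ^ 4 = Z ^ 4) :
    Z < X * Y := by
  -- `X = 1` (or `Y = 1`) is impossible: `Y < Z` forces `Z⁴ ≥ (Y+1)⁴ > Y⁴ + 1`.
  have hYZ : Y < Z := by
    by_contra hle
    have : Z ^ 4 ≤ Y ^ 4 := Nat.pow_le_pow_left (not_lt.mp hle) 4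
    have hX4 : 0 < X ^ 4 := by positivity
    omega
  have hXZ : X < Z := by
    by_contra hle
    have : Z ^ 4 ≤ X ^ 4 := Nat.pow_le_pow_left (not_lt.mp hle) 4
    have hY4 : 0 < Y ^ 4 := by positivity
    omega
  have hX2 : 2 ≤ X := by
    by_contra hlt
    have hX1 : X = 1 := by omega
    subst hX1
    have h1 : (Y + 1) ^ 4 ≤ Z ^ 4 := Nat.pow_le_pow_left hYZ 4
    have h2 : (Y + 1) ^ 4 = Y ^ 4 + 4 * Y ^ 3 + 6 * Y ^ 2 + 4 * Y + 1 := by ring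
    rw [h2] at h1
    have h3 : 0 < Y ^ 3 := pow_pos hY 3
    linarith [pow_pos hY 2]
  have hY2 : 2 ≤ Y := by
    by_contra hlt
    have hY1 : Y = 1 := by omega
    subst hY1
    have h1 : (X + 1) ^ 4 ≤ Z ^ 4 := Nat.pow_le_pow_left hXZ 4
    have h2 : (X + 1) ^ 4 = X ^ 4 + 4 * X ^ 3 + 6 * X ^ 2 + 4 * X + 1 := by ring
    rw [h2] at h1
    have h3 : 0 < X ^ 3 := pow_pos hX 3
    linarith [pow_pos hX 2]
  -- `X, Y ≥ 2`: `(X⁴ − 1)(Y⁴ − 1) > 1`, i.e. `X⁴Y⁴ > X⁴ + Y⁴ = Z⁴`.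
  by_contra hle
  have hle' : X * Y ≤ Z := not_lt.mp hle
  have h4 : (X * Y) ^ 4 ≤ Z ^ 4 := Nat.pow_le_pow_left hle' 4
  have hX4 : 16 ≤ X ^ 4 := by
    calc (16 : ℕ) = 2 ^ 4 := by norm_num
      _ ≤ X ^ 4 := Nat.pow_le_pow_left hX2 4
  have hY4 : 16 ≤ Y ^ 4 := by
    calc (16 : ℕ) = 2 ^ 4 := by norm_num
      _ ≤ Y ^ 4 := Nat.pow_le_pow_left hY2 4
  have hmul : (X * Y) ^ 4 = X ^ 4 * Y ^ 4 := by ring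
  nlinarith [h4, hmul, hX4, hY4, h]

/-- **The Liouville end of the dial holds with constant `1` and no `ε`.**  Every positive level-4 tower
point `a + b = c` has `c < Π²` (strictly; coprimality is not needed).  With the item
`TowerLiouvilleExponent` (`c < √2 · Π^{2+ε}`) this says: at `A = 2` the constant may be taken `C = 1`
and `ε = 0`.  (By `not_towerIneq4_constant_one_exponent_13_10`, with `C = 1` the exponent cannot go
below `1.3007`; the crux is exactly the assertion that it can go below `2`, next theorem.) -/
theorem towerPoint_lt_towerProd_sq (x y z : Fin 4 → ℕ) (hpos : ∀ i, 0 < x i ∧ 0 < y i ∧ 0 < z i)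
    (heq : (∏ i, x i ^ (i.val + 1)) + (∏ i, y i ^ (i.val + 1)) = ∏ i, z i ^ (i.val + 1)) :
    (∏ i, z i ^ (i.val + 1)) < (∏ i, x i * y i * z i) ^ 2 := by
  have hP4 := towerProd_pow_four_eq x y z
  generalize ha : (∏ i, x i ^ (i.val + 1)) = a at heq hP4 ⊢
  generalize hb : (∏ i, y i ^ (i.val + 1)) = b at heq hP4 ⊢
  generalize hc : (∏ i, z i ^ (i.val + 1)) = c at heq hP4 ⊢
  generalize hE : ((x 0 * y 0 * z 0) ^ 3 * (x 1 * y 1 * z 1) ^ 2 * (x 2 * y 2 * z 2)) = E at hP4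
  generalize hP : (∏ i, x i * y i * z i) = P at hP4 ⊢
  have ha0 : 0 < a := by rw [← ha]; exact Finset.prod_pos fun i _ => pow_pos (hpos i).1 _
  have hb0 : 0 < b := by rw [← hb]; exact Finset.prod_pos fun i _ => pow_pos (hpos i).2.1 _
  have hc0 : 0 < c := by omega
  have hE0 : 0 < E := by
    rw [← hE]
    obtain ⟨hx0, hy0, hz0⟩ := hpos 0
    obtain ⟨hx1, hy1, hz1⟩ := hpos 1
    obtain ⟨hx2, hy2, hz2⟩ := hpos 2
    positivity
  -- it suffices to show `c < a * b * E` (then `c * c < a b c E = P⁴`)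
  suffices hkey : c < a * b * E by
    by_contra hle
    have hle' : P ^ 2 ≤ c := not_lt.mp hle
    have h1 : P ^ 4 ≤ c * c := by
      calc P ^ 4 = P ^ 2 * P ^ 2 := by ring
        _ ≤ c * c := Nat.mul_le_mul hle' hle'
    have h2 : c * c < c * (a * b * E) := Nat.mul_lt_mul_of_pos_left hkey hc0
    have h3 : c * (a * b * E) = P ^ 4 := by rw [hP4]; ring
    omega
  rcases Nat.lt_or_ge E 2 with hE1 | hE2
  · -- `E = 1`: all nine low coordinates are `1`, the point is `X⁴ + Y⁴ = Z⁴`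
    have hE1' : E = 1 := by omega
    rw [← hE] at hE1'
    have h0 : x 0 * y 0 * z 0 = 1 := by
      have := Nat.eq_one_of_mul_eq_one_right (Nat.eq_one_of_mul_eq_one_right hE1')
      rcases pow_eq_one_iff.mp this with h | h
      · exact h
      · norm_num at h
    have h1 : x 1 * y 1 * z 1 = 1 := by
      have := Nat.eq_one_of_mul_eq_one_left (Nat.eq_one_of_mul_eq_one_right hE1')
      rcases pow_eq_one_iff.mp this with h | h
      · exact h
      · norm_num at h
    have h2 : x 2 * y 2 * z 2 = 1 := Nat.eq_one_of_mul_eq_one_left hE1'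
    have hx0 : x 0 = 1 := Nat.eq_one_of_mul_eq_one_right (Nat.eq_one_of_mul_eq_one_right h0)
    have hy0 : y 0 = 1 := Nat.eq_one_of_mul_eq_one_left (Nat.eq_one_of_mul_eq_one_right h0)
    have hz0 : z 0 = 1 := Nat.eq_one_of_mul_eq_one_left h0
    have hx1 : x 1 = 1 := Nat.eq_one_of_mul_eq_one_right (Nat.eq_one_of_mul_eq_one_right h1)
    have hy1 : y 1 = 1 := Nat.eq_one_of_mul_eq_one_left (Nat.eq_one_of_mul_eq_one_right h1)
    have hz1 : z 1 = 1 := Nat.eq_one_of_mul_eq_one_left h1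
    have hx2 : x 2 = 1 := Nat.eq_one_of_mul_eq_one_right (Nat.eq_one_of_mul_eq_one_right h2)
    have hy2 : y 2 = 1 := Nat.eq_one_of_mul_eq_one_left (Nat.eq_one_of_mul_eq_one_right h2)
    have hz2 : z 2 = 1 := Nat.eq_one_of_mul_eq_one_left h2
    have ha' : a = x 3 ^ 4 := by rw [← ha, prod_pow_succ_four, hx0, hx1, hx2]; ring
    have hb' : b = y 3 ^ 4 := by rw [← hb, prod_pow_succ_four, hy0, hy1, hy2]; ring
    have hc' : c = z 3 ^ 4 := by rw [← hc, prod_pow_succ_four, hz0, hz1, hz2]; ring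
    have hE1'' : E = 1 := by omega
    rw [ha', hb', hc', hE1'', mul_one]
    rw [ha', hb', hc'] at heq
    have hlt := lt_mul_of_pow_four_add (x 3) (y 3) (z 3) (hpos 3).1 (hpos 3).2.1 heq
    calc z 3 ^ 4 < (x 3 * y 3) ^ 4 := Nat.pow_lt_pow_left hlt (by norm_num)
      _ = x 3 ^ 4 * y 3 ^ 4 := by ring
  · -- `E ≥ 2`
    by_cases hab : a = 1 ∧ b = 1
    · -- `c = 2`, `P⁴ = 2E`: `E = 2` would make `P⁴ = 4`
      obtain ⟨ha1, hb1⟩ := hab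
      subst ha1; subst hb1
      have hc2 : c = 2 := by omega
      subst hc2
      have hE3 : 3 ≤ E := by
        by_contra hlt
        have hE2' : E = 2 := by omega
        rw [hE2'] at hP4
        -- `P⁴ = 4` is impossible
        have hP4' : P ^ 4 = 4 := by simpa using hP4
        rcases Nat.lt_or_ge P 2 with hP1 | hP2
        · interval_cases P <;> simp at hP4'
        · have : 2 ^ 4 ≤ P ^ 4 := Nat.pow_le_pow_left hP2 4
          omega
      omega
    · -- not both `1`: `a + b < 2ab ≤ abE`
      have h3 : 3 ≤ a + b := by omega
      have h2ab : a + b < 2 * (a * b) := by nlinarith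
      calc c = a + b := heq.symm
        _ < 2 * (a * b) := h2ab
        _ ≤ E * (a * b) := Nat.mul_le_mul_right _ hE2
        _ = a * b * E := by ring

/-- Every positive level-4 tower point has `Π ≥ 2` (indeed `Π² > c ≥ 2`). -/
theorem two_le_towerProd (x y z : Fin 4 → ℕ) (hpos : ∀ i, 0 < x i ∧ 0 < y i ∧ 0 < z i)
    (heq : (∏ i, x i ^ (i.val + 1)) + (∏ i, y i ^ (i.val + 1)) = ∏ i, z i ^ (i.val + 1)) :
    2 ≤ ∏ i, x i * y i * z i := by
  have hlt := towerPoint_lt_towerProd_sq x y z hpos heq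
  have ha0 : 0 < ∏ i, x i ^ (i.val + 1) := Finset.prod_pos fun i _ => pow_pos (hpos i).1 _
  have hb0 : 0 < ∏ i, y i ^ (i.val + 1) := Finset.prod_pos fun i _ => pow_pos (hpos i).2.1 _
  by_contra hP
  have hP1 : (∏ i, x i * y i * z i) ≤ 1 := by omega
  have : (∏ i, x i * y i * z i) ^ 2 ≤ 1 := by
    calc (∏ i, x i * y i * z i) ^ 2 ≤ 1 ^ 2 := Nat.pow_le_pow_left hP1 2
      _ = 1 := by norm_num
  omega

/-- **Crux ⟹ its constant-free form.**  If `TowerFourSubLiouville` holds then for some `A < 2` EVERY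
positive coprime level-4 tower point has `c < Π^A` — no constant, no `ε`.  (The converse is immediate with
`C = 1`, since `Π ≥ 1`; so the crux is equivalent to `sup log c / log Π < 2` over all points, each term
being `< 2` by `towerPoint_lt_towerProd_sq`.)  Proof: from `A₀ < 2` and `C = C(ε)`, `ε = (2 − A₀)/3`:
points with `Π^ε ≥ C` have `c < Π^{A₀+2ε}`; the others have `Π ≤ P₀ := max(2, C^{1/ε})` and
`c ≤ Π² − 1 ≤ Π^A` as soon as `P₀^{2−A} ≤ 1 + P₀⁻²`. -/
theorem towerFourSubLiouville_constantFree (h : TowerFourSubLiouville) :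
    ∃ A : ℝ, A < 2 ∧ ∀ x y z : Fin 4 → ℕ, (∀ i, 0 < x i ∧ 0 < y i ∧ 0 < z i) →
      (∏ i, x i ^ (i.val + 1)) + (∏ i, y i ^ (i.val + 1)) = ∏ i, z i ^ (i.val + 1) →
      Nat.Coprime (∏ i, x i ^ (i.val + 1)) (∏ i, y i ^ (i.val + 1)) →
      ((∏ i, z i ^ (i.val + 1) : ℕ) : ℝ) < ((∏ i, x i * y i * z i : ℕ) : ℝ) ^ A := by
  obtain ⟨A₀, hA₀, hT⟩ := h
  set ε : ℝ := (2 - A₀) / 3 with hε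
  have hε0 : 0 < ε := by rw [hε]; linarith
  obtain ⟨C, hC, hTC⟩ := hT ε hε0
  -- threshold `P₀ ≥ 2` with `C ≤ P₀^ε`
  set P₀ : ℝ := max 2 (C ^ (1 / ε)) with hP₀
  have hP₀2 : (2 : ℝ) ≤ P₀ := le_max_left _ _
  have hP₀0 : (0 : ℝ) < P₀ := by linarith
  have hP₀1 : (1 : ℝ) < P₀ := by linarith
  have hCP₀ : C ≤ P₀ ^ ε := by
    have h1 : C ^ (1 / ε) ≤ P₀ := le_max_right _ _
    have h2 : (C ^ (1 / ε)) ^ ε ≤ P₀ ^ ε := Real.rpow_le_rpow (by positivity) h1 hε0.le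
    rwa [← Real.rpow_mul hC.le, one_div_mul_cancel hε0.ne', Real.rpow_one] at h2
  -- the exponent for small points: `A₁ = 2 − δ`, `P₀^δ = 1 + (2P₀²)⁻¹`
  set δ : ℝ := Real.log (1 + (2 * P₀ ^ 2)⁻¹) / Real.log P₀ with hδ
  have hlogP₀ : 0 < Real.log P₀ := Real.log_pos hP₀1
  have hq0 : (0 : ℝ) < (2 * P₀ ^ 2)⁻¹ := by positivity
  have hδ0 : 0 < δ := by
    rw [hδ]; exact div_pos (Real.log_pos (by linarith)) hlogP₀
  have hPδ : P₀ ^ δ = 1 + (2 * P₀ ^ 2)⁻¹ := by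
    rw [Real.rpow_def_of_pos hP₀0, hδ, mul_div_cancel₀ _ hlogP₀.ne', Real.exp_log (by linarith)]
  -- the final exponent
  set A : ℝ := max (A₀ + 2 * ε) (2 - δ) with hA
  have hA2 : A < 2 := by
    rw [hA]; refine max_lt ?_ (by linarith)
    rw [hε]; linarith
  refine ⟨A, hA2, fun x y z hpos heq hcop => ?_⟩
  have hlt := towerPoint_lt_towerProd_sq x y z hpos heq
  have hP2 := two_le_towerProd x y z hpos heq
  have h1 := hTC x y z hpos heq hcop
  generalize hc : (∏ i, z i ^ (i.val + 1)) = c at hlt h1 ⊢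
  generalize hP : (∏ i, x i * y i * z i) = P at hlt hP2 h1 ⊢
  have hPR2 : (2 : ℝ) ≤ (P : ℝ) := by exact_mod_cast hP2
  have hPR1 : (1 : ℝ) < (P : ℝ) := by linarith
  have hPR0 : (0 : ℝ) < (P : ℝ) := by linarith
  rcases le_or_gt P₀ (P : ℝ) with hbig | hsmall
  · -- large `Π`: use the crux, absorb `C` into `Π^ε`
    have hCP : C ≤ (P : ℝ) ^ ε := le_trans hCP₀ (Real.rpow_le_rpow hP₀0.le hbig hε0.le)
    calc (c : ℝ) < C * (P : ℝ) ^ (A₀ + ε) := h1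
      _ ≤ (P : ℝ) ^ ε * (P : ℝ) ^ (A₀ + ε) :=
          mul_le_mul_of_nonneg_right hCP (Real.rpow_nonneg hPR0.le _)
      _ = (P : ℝ) ^ (A₀ + 2 * ε) := by rw [← Real.rpow_add hPR0]; ring_nf
      _ ≤ (P : ℝ) ^ A := Real.rpow_le_rpow_of_exponent_le hPR1.le (le_max_left _ _)
  · -- small `Π`: `c ≤ Π² − 1 < Π² − 1/2 ≤ Π^{2−δ} ≤ Π^A`
    have hc1 : (c : ℝ) ≤ (P : ℝ) ^ 2 - 1 := by
      have : c + 1 ≤ P ^ 2 := hlt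
      have : ((c + 1 : ℕ) : ℝ) ≤ ((P ^ 2 : ℕ) : ℝ) := by exact_mod_cast this
      push_cast at this
      linarith
    have hPδle : (P : ℝ) ^ δ ≤ 1 + (2 * (P : ℝ) ^ 2)⁻¹ := by
      calc (P : ℝ) ^ δ ≤ P₀ ^ δ := Real.rpow_le_rpow hPR0.le hsmall.le hδ0.le
        _ = 1 + (2 * P₀ ^ 2)⁻¹ := hPδ
        _ ≤ 1 + (2 * (P : ℝ) ^ 2)⁻¹ := by gcongr
    have hkey : (P : ℝ) ^ 2 - 1 / 2 ≤ (P : ℝ) ^ (2 - δ) := by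
      have hsplit : (P : ℝ) ^ (2 : ℝ) = (P : ℝ) ^ (2 - δ) * (P : ℝ) ^ δ := by
        rw [← Real.rpow_add hPR0]; ring_nf
      have hP2R : (P : ℝ) ^ (2 : ℝ) = (P : ℝ) ^ 2 := by exact_mod_cast Real.rpow_natCast (P : ℝ) 2
      have hpos' : 0 < (P : ℝ) ^ (2 - δ) := Real.rpow_pos_of_pos hPR0 _
      have h1 : (P : ℝ) ^ 2 ≤ (P : ℝ) ^ (2 - δ) * (1 + (2 * (P : ℝ) ^ 2)⁻¹) := by
        calc (P : ℝ) ^ 2 = (P : ℝ) ^ (2 : ℝ) := hP2R.symm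
          _ = (P : ℝ) ^ (2 - δ) * (P : ℝ) ^ δ := hsplit
          _ ≤ (P : ℝ) ^ (2 - δ) * (1 + (2 * (P : ℝ) ^ 2)⁻¹) :=
              mul_le_mul_of_nonneg_left hPδle hpos'.le
      have h2 : (P : ℝ) ^ (2 - δ) ≤ (P : ℝ) ^ 2 := by
        rw [← hP2R]; exact Real.rpow_le_rpow_of_exponent_le hPR1.le (by linarith)
      have hPsq : (0 : ℝ) < (P : ℝ) ^ 2 := by positivity
      have h3 : (P : ℝ) ^ (2 - δ) * (1 + (2 * (P : ℝ) ^ 2)⁻¹) =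
          (P : ℝ) ^ (2 - δ) + (P : ℝ) ^ (2 - δ) / (P : ℝ) ^ 2 / 2 := by
        field_simp
      have h4 : (P : ℝ) ^ (2 - δ) / (P : ℝ) ^ 2 ≤ 1 := by
        rw [div_le_one hPsq]; exact h2
      have h5 : (P : ℝ) ^ (2 - δ) / (P : ℝ) ^ 2 / 2 ≤ 1 / 2 := by linarith
      linarith
    calc (c : ℝ) ≤ (P : ℝ) ^ 2 - 1 := hc1
      _ < (P : ℝ) ^ 2 - 1 / 2 := by linarith
      _ ≤ (P : ℝ) ^ (2 - δ) := hkey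
      _ ≤ (P : ℝ) ^ A := Real.rpow_le_rpow_of_exponent_le hPR1.le (le_max_right _ _)

end Summit.ABC.ABC.Theorems.TowerFourSubLiouville.Negative
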